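import Mathlib
import Summits.Ventures.HodgeRepro2.T5CyclotomicFifteenBiquadratic

/-!
# THE COMPLETE CENSUS OF THE BIQUADRATIC CM FIELD `F = ℚ(ζ₁₅)^{⟨σ₄⟩} = ℚ(√−3, √5)` BY `p mod 15`

Tier-5 support N2 / N3 / §G-N4.2 (seat p3, gen 81). File 294 reads the census of the non-cyclic CM field `F` at `2`
and `11`; this file gives the whole table through file 293's membership criterion `(−1) · H_F ∈ ⟨p · H_F⟩`
(`H_F = ⟨4⟩`, `(ℤ/15ℤ)ˣ / ⟨4⟩ ≅ C₂ × C₂`, every class of order `≤ 2`):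

| `p mod 15` | `1, 4` | `2, 7, 8, 13` | `11, 14` |
|---|---|---|---|
| `f(P/p)` | `1` | `2` | `2` |
| a place `v` of `F⁺ = ℚ(√5)` above `p` | splits in `F` | SPLITS in `F` | STAYS PRIME |

The middle column is the non-cyclic phenomenon: `f(P/p) = 2` is even, yet `v` splits (`(−1) · H_F ∉ ⟨p · H_F⟩`); the
classes `11, 14` are exactly `p ≡ 2 mod 3` with `p ≡ ±1 mod 5` — `p` inert in `ℚ(√−3)` and split in `ℚ(√5)`.

* `mk_sq_eq_one`: every class of `(ℤ/15ℤ)ˣ / ⟨4⟩` has order `≤ 2`; `neg_one_mem_zpowers_iff`;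
* `fTable`, **`orderOf_mk_eq_fTable`**: `ord(p · ⟨4⟩) = fTable (p % 15)` (`1` on `{1, 4}`, `2` otherwise);
* **`neg_one_mem_zpowers_iff_mod`**: `(−1) · ⟨4⟩ ∈ ⟨p · ⟨4⟩⟩ ⟺ p mod 15 ∈ {11, 14}`;
* **`inertiaDeg_eq_fTable`**, **`exists_map_eq_iff_mod`** (the place of `F⁺` under `P ∣ p` stays prime in `F` ⟺
  `p mod 15 ∈ {11, 14}`), `ncard_primesOver_eq_two_iff_mod`, `even_inertiaDeg_and_ncard_eq_two_of_mod` (the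
  parity-defying classes `2, 7, 8, 13`), and Dirichlet: infinitely many primes in each class.

§8(d): uses an L-value-free non-vanishing device: NO.
-/

open NumberField IsCyclotomicExtension.Rat Ideal IsDedekindDomain IsDedekindDomain.HeightOneSpectrum
open Summit.Ventures.HodgeRepro2.T5CyclotomicSubfieldInertiaDeg
  Summit.Ventures.HodgeRepro2.T5CyclotomicSubfieldDecomposition
  Summit.Ventures.HodgeRepro2.T5CyclotomicTwentyOneSextic
  Summit.Ventures.HodgeRepro2.T5CyclotomicFifteenBiquadratic

namespace Summit.Ventures.HodgeRepro2.T5CyclotomicFifteenTable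

section Table

/-- Every class of `(ℤ/15ℤ)ˣ / ⟨4⟩` squares to `1` (`a² ∈ {1, 4}` for every unit `a mod 15`). -/
theorem mk_sq_eq_one (a : (ZMod 15)ˣ) :
    (QuotientGroup.mk a : (ZMod 15)ˣ ⧸ Subgroup.zpowers u4) ^ 2 = 1 := by
  rw [T5CyclotomicFifteenBiquadratic.mk_pow_eq_one_iff]
  revert a
  decide

/-- `(−1) · ⟨4⟩ ∈ ⟨a · ⟨4⟩⟩ ⟺ −1 ∈ ⟨4⟩ ∨ −a ∈ ⟨4⟩` (every class has order `≤ 2`, and `(−1)⁻¹ · a = −a`). -/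
theorem neg_one_mem_zpowers_iff (a : (ZMod 15)ˣ) :
    (QuotientGroup.mk (-1) : (ZMod 15)ˣ ⧸ Subgroup.zpowers u4) ∈
        Subgroup.zpowers (QuotientGroup.mk a) ↔
      ((-1 : (ZMod 15)ˣ) = 1 ∨ (-1 : (ZMod 15)ˣ) = u4) ∨ (-a = 1 ∨ -a = u4) := by
  rw [mem_zpowers_iff_of_sq_eq_one (mk_sq_eq_one a), QuotientGroup.eq_one_iff,
    mem_zpowers_iff_of_sq_eq_one u4_sq, T5CyclotomicFifteenBiquadratic.mk_eq_mk_iff, inv_neg_one, neg_one_mul]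

/-- **The residue-degree table of `F`**: `f(P/p) = 1` for `p ≡ 1, 4 mod 15`, `= 2` otherwise. -/
def fTable (r : ℕ) : ℕ := if r = 1 ∨ r = 4 then 1 else 2

/-- `p % 15` is prime to `15` iff `p` is. -/
theorem coprime_mod_iff (p : ℕ) : (p % 15).Coprime 15 ↔ p.Coprime 15 := by
  show Nat.gcd (p % 15) 15 = 1 ↔ Nat.gcd p 15 = 1
  rw [← Nat.gcd_rec, Nat.gcd_comm 15 p]

/-- The unit `p mod 15` depends only on `p % 15`. -/
theorem unitOfCoprime_eq_mod (p : ℕ) (hp : p.Coprime 15) :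
    ZMod.unitOfCoprime p hp = ZMod.unitOfCoprime (p % 15) ((coprime_mod_iff p).mpr hp) := by
  rw [Units.ext_iff, ZMod.coe_unitOfCoprime, ZMod.coe_unitOfCoprime, ZMod.natCast_mod]

/-- `ord(r · ⟨4⟩) = fTable r` for every unit class `r < 15`. -/
theorem orderOf_mk_eq_fTable_of_lt (r : ℕ) (hr : r < 15) (hr' : r.Coprime 15) :
    orderOf (QuotientGroup.mk (ZMod.unitOfCoprime r hr') : (ZMod 15)ˣ ⧸ Subgroup.zpowers u4) =
      fTable r := by
  interval_cases r <;>
    first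
    | exact absurd hr' (by decide)
    | exact T5CyclotomicFifteenBiquadratic.orderOf_mk_eq _ hr' _ (by decide) (by decide) (by decide)

/-- **`ord(p · ⟨4⟩) = fTable (p % 15)`**. -/
theorem orderOf_mk_eq_fTable (p : ℕ) (hp : p.Coprime 15) :
    orderOf (QuotientGroup.mk (ZMod.unitOfCoprime p hp) : (ZMod 15)ˣ ⧸ Subgroup.zpowers u4) =
      fTable (p % 15) := by
  rw [unitOfCoprime_eq_mod]
  exact orderOf_mk_eq_fTable_of_lt (p % 15) (Nat.mod_lt _ (by norm_num)) _

/-- `(−1) · ⟨4⟩ ∈ ⟨r · ⟨4⟩⟩` exactly for the unit classes `r ∈ {11, 14}`. -/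
theorem neg_one_mem_zpowers_iff_of_lt (r : ℕ) (hr : r < 15) (hr' : r.Coprime 15) :
    (QuotientGroup.mk (-1) : (ZMod 15)ˣ ⧸ Subgroup.zpowers u4) ∈
        Subgroup.zpowers (QuotientGroup.mk (ZMod.unitOfCoprime r hr')) ↔
      r ∈ ({11, 14} : Finset ℕ) := by
  rw [neg_one_mem_zpowers_iff]
  simp only [Units.ext_iff, Units.val_neg, Units.val_one, u4_val, ZMod.coe_unitOfCoprime]
  interval_cases r <;> first | exact absurd hr' (by decide) | decide

/-- **`(−1) · ⟨4⟩ ∈ ⟨p · ⟨4⟩⟩ ⟺ p mod 15 ∈ {11, 14}`**. -/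
theorem neg_one_mem_zpowers_iff_mod (p : ℕ) (hp : p.Coprime 15) :
    (QuotientGroup.mk (-1) : (ZMod 15)ˣ ⧸ Subgroup.zpowers u4) ∈
        Subgroup.zpowers (QuotientGroup.mk (ZMod.unitOfCoprime p hp)) ↔
      p % 15 ∈ ({11, 14} : Finset ℕ) := by
  rw [unitOfCoprime_eq_mod]
  exact neg_one_mem_zpowers_iff_of_lt (p % 15) (Nat.mod_lt _ (by norm_num)) _

/-- `fTable r = 1` exactly on `{1, 4}`, among the unit classes. -/
theorem fTable_eq_one_iff : ∀ r ∈ Finset.range 15, r.Coprime 15 →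
    (fTable r = 1 ↔ r ∈ ({1, 4} : Finset ℕ)) := by decide

/-- `fTable r = 2` exactly on `{2, 7, 8, 11, 13, 14}`, among the unit classes. -/
theorem fTable_eq_two_iff : ∀ r ∈ Finset.range 15, r.Coprime 15 →
    (fTable r = 2 ↔ r ∈ ({2, 7, 8, 11, 13, 14} : Finset ℕ)) := by decide

end Table

section Field

variable (L : Type*) [Field L] [NumberField L] [IsCyclotomicExtension {15} ℚ L]
variable (p : ℕ) [hp : Fact p.Prime] (hpm : p.Coprime 15)
  (P : Ideal (𝓞 (fixedField L))) [hP : P.IsPrime] [hPp : P.LiesOver (span {(p : ℤ)})]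

include hpm hP hPp in
/-- **`f(P/p) = fTable (p % 15)`** for every prime `p ∤ 15` and every prime `P` of `F` above it. -/
theorem inertiaDeg_eq_fTable : P.inertiaDeg ℤ = fTable (p % 15) := by
  rw [inertiaDeg_eq_orderOf_mk 15 L (fixedField L) p hpm P, orderOf_mk_congr (zmodSubgroup_eq L),
    orderOf_mk_eq_fTable]

variable (v : HeightOneSpectrum (𝓞 (maximalRealSubfield (fixedField L)))) [hPv : P.LiesOver v.asIdeal]

include hpm hP hPp hPv in
/-- **THE CENSUS OF `F = ℚ(√−3, √5)` BY `p mod 15`**: the place `v` of `F⁺` under `P ∣ p` stays prime in `F` iff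
`p mod 15 ∈ {11, 14}`. -/
theorem exists_map_eq_iff_mod :
    (∃ w : HeightOneSpectrum (𝓞 (fixedField L)),
        Ideal.map (algebraMap (𝓞 (maximalRealSubfield (fixedField L))) (𝓞 (fixedField L))) v.asIdeal =
          w.asIdeal) ↔
      p % 15 ∈ ({11, 14} : Finset ℕ) := by
  haveI := isCMField_cyclotomic L
  haveI := isCMField_fixedField L
  rw [exists_map_eq_iff_mem_zpowers 15 L (fixedField L) p hpm P v, mem_zpowers_mk_congr (zmodSubgroup_eq L),
    neg_one_mem_zpowers_iff_mod]

include hpm hP hPp hPv in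
/-- Two primes of `F` above `v` iff `p mod 15 ∉ {11, 14}`. -/
theorem ncard_primesOver_eq_two_iff_mod :
    (v.asIdeal.primesOver (𝓞 (fixedField L))).ncard = 2 ↔ p % 15 ∉ ({11, 14} : Finset ℕ) := by
  haveI := isCMField_cyclotomic L
  haveI := isCMField_fixedField L
  rw [ncard_primesOver_eq_two_iff_notMem 15 L (fixedField L) p hpm P v, mem_zpowers_mk_congr (zmodSubgroup_eq L),
    neg_one_mem_zpowers_iff_mod]

include hpm hP hPp hPv in
/-- **THE PARITY-DEFYING CLASSES**: for `p ≡ 2, 7, 8, 13 mod 15`, `f(P/p) = 2` is even and yet the place `v` of `F⁺`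
under `P` has TWO primes of `F` above it. -/
theorem even_inertiaDeg_and_ncard_eq_two_of_mod (h : p % 15 ∈ ({2, 7, 8, 13} : Finset ℕ)) :
    Even (P.inertiaDeg ℤ) ∧ (v.asIdeal.primesOver (𝓞 (fixedField L))).ncard = 2 := by
  have hr : p % 15 ∈ ({2, 7, 8, 11, 13, 14} : Finset ℕ) := by
    simp only [Finset.mem_insert, Finset.mem_singleton] at h ⊢
    omega
  refine ⟨?_, ?_⟩
  · rw [inertiaDeg_eq_fTable L p hpm P, (fTable_eq_two_iff (p % 15) (Finset.mem_range.mpr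
      (Nat.mod_lt _ (by norm_num))) ((coprime_mod_iff p).mpr hpm)).mpr hr]
    decide
  · rw [ncard_primesOver_eq_two_iff_mod L p hpm P v]
    simp only [Finset.mem_insert, Finset.mem_singleton] at h ⊢
    omega

/-- **Dirichlet on `(ℤ/15ℤ)ˣ`**: every unit class mod `15` contains infinitely many primes. -/
theorem infinite_setOf_prime_eq_mod (r : ℕ) (hr : r.Coprime 15) :
    {q : ℕ | q.Prime ∧ q % 15 = r % 15}.Infinite := by
  have h := Nat.infinite_setOf_prime_and_eq_mod (q := 15) (ZMod.unitOfCoprime r hr).isUnit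
  refine h.mono ?_
  rintro q ⟨hq, hqr⟩
  refine ⟨hq, ?_⟩
  rw [ZMod.coe_unitOfCoprime] at hqr
  exact (ZMod.natCast_eq_natCast_iff' q r 15).mp hqr

end Field

end Summit.Ventures.HodgeRepro2.T5CyclotomicFifteenTable
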